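import Summits.AtomisticToContinuum.HydrodynamicLimit.Theorems.InformationPercolationEnginePercolationClosesChaosForecastDefs
import HarnessLib

/-!
# Docking S7 of the line `equilibrium-forecast-chain-rule` (crux `InformationPercolationEngine.PercolationClosesChaos`,
stmt-AtomisticToContinuum-15178) — piece F0: the smallness budget of the docking

Support file (`--supports stmt-AtomisticToContinuum-15178`) of the registered stub `stub_docking` (worker S7 of lead c2).
Pure real arithmetic: the deterministic bound of the target's defect on a good orbit (piece F2, `abs_dockDefect_le`) is
`π σ³ ×` a combination `BOUND(ηN, η₁, b₁, b₂, ρ, Δ; T₂, ϖ, Q)` of the tolerances of the three kinetic hypotheses (`ηN` for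
`NoMesoscopicOscillation` (i), `b₁` for `KineticCellChaosLG` at level `η₁` and truncation `2T₂`, `b₂` for `LocalCountUI` (i) at
level `T₂`), of the modulus `ρ` of the localiser and of the step length `Δ`, with nonnegative coefficients. `docking_budget`
(registered helper) chooses them IN THE ORDER THE QUANTIFIERS OF THE HYPOTHESES ALLOW — `ηN` first (before `r₀`), then `b₂`
(after `r`, before the level `T₂` it buys), then `η₁, ρ, b₁` (after `T₂`), then the `Δ`-threshold `θ` (after the modulus
`ϖ(ρ)` of `χ` and the energy/cell-count constant `Q = √(2E₀ n̄ T₂)`) — so that `π σ³ · BOUND ≤ η`.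
-/

noncomputable section

open MeasureTheory Set Filter Topology
open scoped ENNReal BigOperators Classical

namespace Summit.AtomisticToContinuum.HydrodynamicLimit.Theorems.EquilibriumForecastLine

/-- `A · x ≤ η/6` when `x ≤ η / (6(A+1))`, `A, η ≥ 0`. [folklore] -/
theorem mul_le_sixth {A x η : ℝ} (hA : 0 ≤ A) (hη : 0 ≤ η) (hxle : x ≤ η / (6 * (A + 1))) : A * x ≤ η / 6 := by
  have h1 : A * x ≤ A * (η / (6 * (A + 1))) := mul_le_mul_of_nonneg_left hxle hA
  have h2 : A * (η / (6 * (A + 1))) ≤ η / 6 := by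
    rw [mul_div_assoc', div_le_div_iff₀ (by positivity) (by positivity)]
    nlinarith
  exact h1.trans h2

/-- A positive threshold below `1` and below `η / (6(A+1))`. [folklore] -/
theorem exists_small_le_one {A η : ℝ} (hA : 0 ≤ A) (hη : 0 < η) :
    ∃ x : ℝ, 0 < x ∧ x ≤ 1 ∧ x ≤ η / (6 * (A + 1)) :=
  ⟨min 1 (η / (6 * (A + 1))), lt_min one_pos (by positivity), min_le_left _ _, min_le_right _ _⟩

/-- **Registered helper `docking_budget` (piece F0 of the docking S7): the smallness budget.** For nonnegative constants and
`P, τ, η > 0` there are, in this order, `ηN > 0`, `b₂ ∈ (0, 1]`, and for every level `T₂ ≥ 0` tolerances `η₁, ρ, b₁ > 0`, and for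
every modulus `ϖ > 0` and `Q ≥ 0` a threshold `θ > 0`, such that for `0 < Δ ≤ θ` the docking bound is at most `η`. [folklore] -/
theorem docking_budget : ∀ (P Cχ CΨ S₁ SΨ Kt₁ Kx₁ KtΨ KxΨ τ η : ℝ), 0 < P → 0 ≤ Cχ → 0 ≤ CΨ → 0 ≤ S₁ → 0 ≤ SΨ → 0 ≤ Kt₁ → 0 ≤ Kx₁ → 0 ≤ KtΨ → 0 ≤ KxΨ → 0 < τ → 0 < η → ∃ ηN : ℝ, 0 < ηN ∧ ∃ b₂ : ℝ, 0 < b₂ ∧ b₂ ≤ 1 ∧ ∀ T₂ : ℝ, 0 ≤ T₂ → ∃ η₁ : ℝ, 0 < η₁ ∧ ∃ ρ : ℝ, 0 < ρ ∧ ∃ b₁ : ℝ, 0 < b₁ ∧ ∀ ϖ : ℝ, 0 < ϖ → ∀ Q : ℝ, 0 ≤ Q → ∃ θ : ℝ, 0 < θ ∧ ∀ Δ : ℝ, 0 < Δ → Δ ≤ θ → P * (Cχ * τ * ηN + Cχ * S₁ * (2 * η₁ * (27 * T₂ * τ + 2 * τ * b₂) + 2 * CΨ * τ * b₁ + 4 *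 CΨ * (2 * τ * b₂)) + (Cχ * (CΨ * Kt₁ + KtΨ) * Δ + Cχ * (CΨ * Kx₁ + KxΨ) * (Real.sqrt 3 / 2 * Δ) + ρ * (CΨ * S₁ + SΨ)) * (27 * T₂ * τ + 2 * τ * b₂) + (Cχ * (CΨ * Kx₁ + KxΨ) + 4 * Cχ / ϖ * (CΨ * S₁ + SΨ)) * (Q * Δ * (τ + 27 * T₂ * τ + 2 * τ * b₂)) + 2 * (Cχ * (CΨ * S₁ + SΨ)) * (2 * τ * b₂) + Cχ * (CΨ * S₁ + SΨ) * (27 * T₂ * Δ + 2 * τ * b₂)) ≤ η := by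
  intro P Cχ CΨ S₁ SΨ Kt₁ Kx₁ KtΨ KxΨ τ η hP hCχ hCΨ hS1 hSΨ hKt₁ hKx₁ hKtΨ hKxΨ hτ hη
  -- the `r`-level constants
  set CP := CΨ * S₁ + SΨ with hCP
  set a₁ := Cχ * (CΨ * Kt₁ + KtΨ) + Cχ * (CΨ * Kx₁ + KxΨ) * (Real.sqrt 3 / 2) with ha₁
  set D₂ := 2 * (Cχ * S₁) + 4 * (Cχ * S₁ * CΨ) + a₁ + CP + 1 + 3 * (Cχ * CP) with hD₂
  have hCP0 : 0 ≤ CP := by positivity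
  have h32 : 0 ≤ Real.sqrt 3 / 2 := by positivity
  have ha₁0 : 0 ≤ a₁ := by positivity
  have hD₂0 : 0 ≤ D₂ := by positivity
  -- `ηN`, `b₂`
  refine ⟨η / (6 * (P * Cχ * τ + 1)), by positivity, ?_⟩
  obtain ⟨b₂, hb₂, hb₂1, hb₂le⟩ := exists_small_le_one (A := P * (2 * τ) * D₂) (by positivity) hη
  refine ⟨b₂, hb₂, hb₂1, fun T₂ hT₂ => ?_⟩
  -- `η₁`, `ρ`, `b₁`
  obtain ⟨η₁, hη₁, hη₁1, hη₁le⟩ := exists_small_le_one (A := 54 * P * Cχ * S₁ * T₂ * τ) (by positivity) hη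
  obtain ⟨ρ, hρ, hρ1, hρle⟩ := exists_small_le_one (A := 27 * P * CP * T₂ * τ) (by positivity) hη
  refine ⟨η₁, hη₁, ρ, hρ, η / (6 * (2 * P * Cχ * S₁ * CΨ * τ + 1)), by positivity, fun ϖ hϖ Q hQ => ?_⟩
  -- `θ`
  set β := Cχ * (CΨ * Kx₁ + KxΨ) + 4 * Cχ / ϖ * CP with hβ
  have hβ0 : 0 ≤ β := by positivity
  obtain ⟨θ₁, hθ₁, hθ₁1, hθ₁le⟩ := exists_small_le_one
    (A := P * (27 * a₁ * T₂ * τ + β * Q * (τ + 27 * T₂ * τ) + 27 * Cχ * CP * T₂)) (by positivity) hη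
  refine ⟨min θ₁ (1 / (β * Q + 1)), lt_min hθ₁ (by positivity), fun Δ hΔ hΔθ => ?_⟩
  have hΔθ₁ : Δ ≤ θ₁ := hΔθ.trans (min_le_left _ _)
  have hΔ1 : Δ ≤ 1 := hΔθ₁.trans hθ₁1
  have hβQΔ : β * Q * Δ ≤ 1 := by
    have h1 : β * Q * Δ ≤ β * Q * (1 / (β * Q + 1)) := mul_le_mul_of_nonneg_left (hΔθ.trans (min_le_right _ _)) (by positivity)
    have h2 : β * Q * (1 / (β * Q + 1)) ≤ 1 := by
      rw [mul_one_div, div_le_one (by positivity)]; linarith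
    exact h1.trans h2
  -- the six groups
  have G1 : P * Cχ * τ * (η / (6 * (P * Cχ * τ + 1))) ≤ η / 6 := mul_le_sixth (by positivity) hη.le le_rfl
  have Gη : 54 * P * Cχ * S₁ * T₂ * τ * η₁ ≤ η / 6 := mul_le_sixth (by positivity) hη.le hη₁le
  have Gb1 : 2 * P * Cχ * S₁ * CΨ * τ * (η / (6 * (2 * P * Cχ * S₁ * CΨ * τ + 1))) ≤ η / 6 :=
    mul_le_sixth (by positivity) hη.le le_rfl
  have Gρ : 27 * P * CP * T₂ * τ * ρ ≤ η / 6 := mul_le_sixth (by positivity) hη.le hρle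
  have GΔ : P * (27 * a₁ * T₂ * τ + β * Q * (τ + 27 * T₂ * τ) + 27 * Cχ * CP * T₂) * Δ ≤ η / 6 :=
    mul_le_sixth (by positivity) hη.le (hΔθ₁.trans hθ₁le)
  have Gb2 : P * (2 * τ) * D₂ * b₂ ≤ η / 6 := mul_le_sixth (by positivity) hη.le hb₂le
  -- the `b₂`-bracket is at most `D₂`
  have hbr : 2 * (Cχ * S₁) * η₁ + 4 * (Cχ * S₁ * CΨ) +
      (Cχ * (CΨ * Kt₁ + KtΨ) * Δ + Cχ * (CΨ * Kx₁ + KxΨ) * (Real.sqrt 3 / 2 * Δ) + ρ * CP) + β * Q * Δ + 3 * (Cχ * CP) ≤ D₂ := by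
    have e1 : 2 * (Cχ * S₁) * η₁ ≤ 2 * (Cχ * S₁) := mul_le_of_le_one_right (by positivity) hη₁1
    have e2 : Cχ * (CΨ * Kt₁ + KtΨ) * Δ ≤ Cχ * (CΨ * Kt₁ + KtΨ) := mul_le_of_le_one_right (by positivity) hΔ1
    have e3 : Cχ * (CΨ * Kx₁ + KxΨ) * (Real.sqrt 3 / 2 * Δ) ≤ Cχ * (CΨ * Kx₁ + KxΨ) * (Real.sqrt 3 / 2) := by
      rw [← mul_assoc]; exact mul_le_of_le_one_right (by positivity) hΔ1
    have e4 : ρ * CP ≤ CP := mul_le_of_le_one_left hCP0 hρ1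
    rw [hD₂, ha₁]
    linarith
  have Gb2' : P * (2 * τ) * b₂ * (2 * (Cχ * S₁) * η₁ + 4 * (Cχ * S₁ * CΨ) +
      (Cχ * (CΨ * Kt₁ + KtΨ) * Δ + Cχ * (CΨ * Kx₁ + KxΨ) * (Real.sqrt 3 / 2 * Δ) + ρ * CP) + β * Q * Δ + 3 * (Cχ * CP)) ≤ η / 6 :=
    (mul_le_mul_of_nonneg_left hbr (by positivity)).trans (by linarith)
  -- assemble: the bound is the sum of the six groups
  have hid : P * (Cχ * τ * (η / (6 * (P * Cχ * τ + 1))) + Cχ * S₁ * (2 * η₁ * (27 * T₂ * τ + 2 * τ * b₂) +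
      2 * CΨ * τ * (η / (6 * (2 * P * Cχ * S₁ * CΨ * τ + 1))) + 4 * CΨ * (2 * τ * b₂)) +
      (Cχ * (CΨ * Kt₁ + KtΨ) * Δ + Cχ * (CΨ * Kx₁ + KxΨ) * (Real.sqrt 3 / 2 * Δ) + ρ * CP) * (27 * T₂ * τ + 2 * τ * b₂) +
      β * (Q * Δ * (τ + 27 * T₂ * τ + 2 * τ * b₂)) + 2 * (Cχ * CP) * (2 * τ * b₂) + Cχ * CP * (27 * T₂ * Δ + 2 * τ * b₂)) =
      P * Cχ * τ * (η / (6 * (P * Cχ * τ + 1))) + 54 * P * Cχ * S₁ * T₂ * τ * η₁ +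
        2 * P * Cχ * S₁ * CΨ * τ * (η / (6 * (2 * P * Cχ * S₁ * CΨ * τ + 1))) + 27 * P * CP * T₂ * τ * ρ +
        P * (27 * a₁ * T₂ * τ + β * Q * (τ + 27 * T₂ * τ) + 27 * Cχ * CP * T₂) * Δ +
        P * (2 * τ) * b₂ * (2 * (Cχ * S₁) * η₁ + 4 * (Cχ * S₁ * CΨ) +
          (Cχ * (CΨ * Kt₁ + KtΨ) * Δ + Cχ * (CΨ * Kx₁ + KxΨ) * (Real.sqrt 3 / 2 * Δ) + ρ * CP) + β * Q * Δ + 3 * (Cχ * CP)) := by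
    rw [ha₁]; ring
  rw [hid]
  linarith

end Summit.AtomisticToContinuum.HydrodynamicLimit.Theorems.EquilibriumForecastLine

end
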